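import Summits.QuantumAdvantage.AdviceFreeQNC0.WalkTransport

/-!
# OddPrimeWalk — the THREE-BLIND-BITS LAW (planner qa-qnc0-p2 g32, Sketch32 `ThreeBlindBitsLaw`, ROUND-32 §2)

Cell qa-qnc0, route OddPrimeWalk; support for the register-rigidity crux (R₁) `SingleClassRegisterRigidityFive`
(stmt-QuantumAdvantage-24200): the MOVE PRINCIPLE in its simplest instance.  Prover qn-prover-3 g19.

THEOREM `oddPrimeWalk_threeBlindBitsLaw` (the planner's typed signature): a u-walk strategy `y` (ARBITRARY fire rules, any `n`,
any charge `c`) that ignores three input bits `i < j < k` wins on at most `7/8 · 2ⁿ` inputs: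
`8 · #{u : ringWinU c y u} ≤ 7 · 2ⁿ`.

PROOF (a five-term parity identity; no case tables).  Fix a base point `u` vanishing at `i, j, k` and consider the completions
`u^S` (`S ⊆ {i,j,k}` set to `1`).  Blindness makes the fired set `{g : y_g(u^S)}` independent of `S`; the completion shifts the
weight by `|S|` and the prefix weight at cut `g` by `q_S(g) = #{s ∈ S : s < g}`, so
`WIN(u^S) ⇔ #{g fired : c + g + |u| + W_g(u) + |S| + q_S(g) ≢ 0 (mod 3)}` is odd (`card_win_fillS`).  For the FIVE sets
`S ∈ {∅, {j}, {i,j}, {i,k}, {j,k}}` and ANY cut `g`, the shifts `|S| + q_S(g) (mod 3)` hit every residue class an odd number of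
times (check the four positions of `g` relative to `i < j < k`), so each fired cut is live for an EVEN number of the five
completions: `Σ_{five S} WIN-count(u^S) ≡ 0 (mod 2)` (`five_card_win_even`).  Five odd numbers cannot have an even sum, so one
of the five completions LOSES (`exists_loser_fillS`).  The fibres `{u' : u' agrees with u off {i,j,k}}` have `8` elements and
partition the cube; each contains a loser (`oddPrimeWalk_threeBlindBitsLaw`).  The constant `7/8` is tight (planner's
blind_max.py; not claimed here).
WHAT THIS IS NOT: (R₁) itself (item 24200) is NOT proved; no separation moved.
-/

namespace Summit.QuantumAdvantage.AdviceFreeQNC0.OddConfig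

open Finset

variable {n : ℕ}

/-! ### Completions of a base point -/

/-- the completion `u^S`: the bits of `S` set to `1`. -/
def fillS (u : Fin n → Bool) (S : Finset (Fin n)) : Fin n → Bool := fun t => u t || decide (t ∈ S)

/-- `u^∅ = u`. -/
theorem fillS_empty (u : Fin n → Bool) : fillS u ∅ = u := by
  funext t
  simp [fillS]

/-- `u^{S ∪ {s}} = (u^S)[s ↦ 1]`. -/
theorem fillS_insert (u : Fin n → Bool) (S : Finset (Fin n)) (s : Fin n) :
    fillS u (insert s S) = Function.update (fillS u S) s true := by
  funext t
  by_cases h : t = s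
  · subst h
    simp [fillS]
  · rw [Function.update_of_ne h]
    simp [fillS, h]

/-- a strategy blind to every bit of `S` does not see the completion. -/
theorem apply_fillS_of_blind (y : Fin (n + 1) → (Fin n → Bool) → Bool) (S : Finset (Fin n))
    (hS : ∀ s ∈ S, ∀ g u b, y g (Function.update u s b) = y g u) (g : Fin (n + 1)) (u : Fin n → Bool) :
    y g (fillS u S) = y g u := by
  induction S using Finset.induction_on generalizing u with
  | empty => rw [fillS_empty]
  | insert s S hs ih =>
    rw [fillS_insert, hS s (mem_insert_self s S) g, ih (fun s' hs' => hS s' (mem_insert_of_mem hs'))]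

/-- the ones of `u^S`: those of `u` together with `S` (disjointly, when `u` vanishes on `S`). -/
theorem filter_fillS_eq (u : Fin n → Bool) (S : Finset (Fin n)) (P : Fin n → Prop) [DecidablePred P] :
    (univ.filter fun t : Fin n => P t ∧ fillS u S t = true)
      = (univ.filter fun t : Fin n => P t ∧ u t = true) ∪ S.filter P := by
  ext t
  simp only [fillS, mem_union, mem_filter, mem_univ, true_and, Bool.or_eq_true, decide_eq_true_eq]
  constructor
  · rintro ⟨hP, h | h⟩
    · exact Or.inl ⟨hP, h⟩
    · exact Or.inr ⟨h, hP⟩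
  · rintro (⟨hP, h⟩ | ⟨h, hP⟩)
    · exact ⟨hP, Or.inl h⟩
    · exact ⟨hP, Or.inr h⟩

/-- weight of a completion: `|u^S| = |u| + |S|`. -/
theorem wt_fillS (u : Fin n → Bool) (S : Finset (Fin n)) (hS : ∀ s ∈ S, u s = false) :
    wt (fillS u S) = wt u + S.card := by
  unfold wt
  have e : (univ.filter fun t : Fin n => fillS u S t = true) = (univ.filter fun t : Fin n => u t = true) ∪ S := by
    ext t
    simp only [fillS, mem_union, mem_filter, mem_univ, true_and, Bool.or_eq_true, decide_eq_true_eq]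
  rw [e, card_union_of_disjoint]
  rw [disjoint_left]
  intro t ht htS
  rw [mem_filter] at ht
  rw [hS t htS] at ht
  simp at ht

/-- prefix weight of a completion: `W_g(u^S) = W_g(u) + #{s ∈ S : s < g}`. -/
theorem wtPrefix_fillS (u : Fin n → Bool) (S : Finset (Fin n)) (hS : ∀ s ∈ S, u s = false) (g : ℕ) :
    wtPrefix (fillS u S) g = wtPrefix u g + (S.filter fun s => s.val < g).card := by
  unfold wtPrefix
  rw [filter_fillS_eq u S (fun t : Fin n => t.val < g), card_union_of_disjoint]
  rw [disjoint_left]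
  intro t ht htS
  rw [mem_filter] at ht htS
  rw [hS t htS.1] at ht
  simp at ht

/-! ### The win count of a completion -/

/-- live fired cuts of the completion `u^S`, written in the base point's coordinates. -/
def cardWinFill (c : ℕ) (y : Fin (n + 1) → (Fin n → Bool) → Bool) (u : Fin n → Bool) (S : Finset (Fin n)) : ℕ :=
  (univ.filter fun g : Fin (n + 1) => y g u = true ∧
    (c + g.val + wt u + wtPrefix u g.val + (S.card + (S.filter fun s => s.val < g.val).card)) % 3 ≠ 0).card

/-- `WIN(u^S) ⇔ cardWinFill` is odd (blind strategy, `u` vanishing on `S`). -/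
theorem card_win_fillS (c : ℕ) (y : Fin (n + 1) → (Fin n → Bool) → Bool) (u : Fin n → Bool) (S : Finset (Fin n))
    (hS : ∀ s ∈ S, u s = false) (hbl : ∀ g, y g (fillS u S) = y g u) :
    ringWinU c y (fillS u S) = true ↔ cardWinFill c y u S % 2 = 1 := by
  unfold ringWinU walkExp cardWinFill
  rw [decide_eq_true_eq]
  have e : (univ.filter fun g : Fin (n + 1) =>
      y g (fillS u S) = true ∧ (c + g.val + (wt (fillS u S) + wtPrefix (fillS u S) g.val)) % 3 ≠ 0)
      = univ.filter fun g : Fin (n + 1) => y g u = true ∧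
          (c + g.val + wt u + wtPrefix u g.val + (S.card + (S.filter fun s => s.val < g.val).card)) % 3 ≠ 0 := by
    refine filter_congr fun g _ => ?_
    rw [hbl g, wt_fillS u S hS, wtPrefix_fillS u S hS]
    constructor
    · rintro ⟨h1, h2⟩
      refine ⟨h1, fun h => h2 ?_⟩
      omega
    · rintro ⟨h1, h2⟩
      refine ⟨h1, fun h => h2 ?_⟩
      omega
  rw [e]

/-- **the five-term parity identity**: over the completions by `∅, {j}, {i,j}, {i,k}, {j,k}` (`i < j < k`) every cut is live an
EVEN number of times, so the five win counts have an even sum. -/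
theorem five_card_win_even (c : ℕ) (y : Fin (n + 1) → (Fin n → Bool) → Bool) (u : Fin n → Bool) (i j k : Fin n)
    (hij : i < j) (hjk : j < k) :
    (cardWinFill c y u ∅ + cardWinFill c y u {j} + cardWinFill c y u {i, j} + cardWinFill c y u {i, k}
      + cardWinFill c y u {j, k}) % 2 = 0 := by
  have hij' : i.val < j.val := hij
  have hjk' : j.val < k.val := hjk
  have nij : i ≠ j := fun h => by rw [h] at hij'; omega
  have nik : i ≠ k := fun h => by rw [h] at hij'; omega
  have njk : j ≠ k := fun h => by rw [h] at hjk'; omega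
  unfold cardWinFill
  simp only [card_filter, ← sum_add_distrib]
  rw [sum_nat_mod, sum_eq_zero]
  · norm_num
  intro g _
  by_cases hy : y g u = true
  · simp only [hy, true_and, sum_empty, card_empty, sum_singleton, card_singleton, sum_pair nij, card_pair nij,
      sum_pair nik, card_pair nik, sum_pair njk, card_pair njk]
    split_ifs <;> omega
  · simp [hy]

/-- **a loser in every fibre**: if `y` ignores the bits `i < j < k` and `u` vanishes there, some completion `u^S`,
`S ⊆ {i,j,k}`, loses. -/
theorem exists_loser_fillS (c : ℕ) (y : Fin (n + 1) → (Fin n → Bool) → Bool) (i j k : Fin n) (hij : i < j) (hjk : j < k)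
    (hI : ∀ g u b, y g (Function.update u i b) = y g u) (hJ : ∀ g u b, y g (Function.update u j b) = y g u)
    (hK : ∀ g u b, y g (Function.update u k b) = y g u) (u : Fin n → Bool)
    (hu : u i = false ∧ u j = false ∧ u k = false) :
    ∃ S : Finset (Fin n), S ⊆ {i, j, k} ∧ ringWinU c y (fillS u S) = false := by
  have hbl : ∀ S : Finset (Fin n), S ⊆ {i, j, k} → ∀ g, y g (fillS u S) = y g u := by
    intro S hS g
    refine apply_fillS_of_blind y S (fun s hs => ?_) g u
    have hs' := hS hs
    simp only [mem_insert, mem_singleton] at hs'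
    rcases hs' with rfl | rfl | rfl
    · exact hI
    · exact hJ
    · exact hK
  have hz : ∀ S : Finset (Fin n), S ⊆ {i, j, k} → ∀ s ∈ S, u s = false := by
    intro S hS s hs
    have hs' := hS hs
    simp only [mem_insert, mem_singleton] at hs'
    rcases hs' with rfl | rfl | rfl
    · exact hu.1
    · exact hu.2.1
    · exact hu.2.2
  have h1 : (∅ : Finset (Fin n)) ⊆ {i, j, k} := empty_subset _
  have h2 : ({j} : Finset (Fin n)) ⊆ {i, j, k} := by
    intro s hs; rw [mem_singleton] at hs; subst hs; simp
  have h3 : ({i, j} : Finset (Fin n)) ⊆ {i, j, k} := by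
    intro s hs; simp only [mem_insert, mem_singleton] at hs ⊢; tauto
  have h4 : ({i, k} : Finset (Fin n)) ⊆ {i, j, k} := by
    intro s hs; simp only [mem_insert, mem_singleton] at hs ⊢; tauto
  have h5 : ({j, k} : Finset (Fin n)) ⊆ {i, j, k} := by
    intro s hs; simp only [mem_insert, mem_singleton] at hs ⊢; tauto
  by_contra hno
  push Not at hno
  have w : ∀ S : Finset (Fin n), S ⊆ {i, j, k} → cardWinFill c y u S % 2 = 1 := by
    intro S hS
    rw [← card_win_fillS c y u S (hz S hS) (hbl S hS)]
    have h := hno S hS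
    revert h
    cases ringWinU c y (fillS u S) <;> simp
  have e := five_card_win_even c y u i j k hij hjk
  have w1 := w _ h1
  have w2 := w _ h2
  have w3 := w _ h3
  have w4 := w _ h4
  have w5 := w _ h5
  omega

/-! ### Counting over the fibres -/

/-- clearing the three bits. -/
def clr (i j k : Fin n) (u : Fin n → Bool) : Fin n → Bool := fun t => if t = i ∨ t = j ∨ t = k then false else u t

/-- the fibre of a base point is among the `8` completions of that base point. -/
theorem card_fibre_le (i j k : Fin n) (u₀ : Fin n → Bool) :
    (univ.filter fun u : Fin n → Bool => clr i j k u = u₀).card ≤ 8 := by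
  classical
  have hsub : (univ.filter fun u : Fin n → Bool => clr i j k u = u₀)
      ⊆ (({i, j, k} : Finset (Fin n)).powerset).image (fillS u₀) := by
    intro u hu
    rw [mem_filter] at hu
    rw [mem_image]
    refine ⟨({i, j, k} : Finset (Fin n)).filter (fun t => u t = true), mem_powerset.mpr (filter_subset _ _), ?_⟩
    funext t
    have ht := congrFun hu.2 t
    simp only [clr] at ht
    simp only [fillS, mem_filter, mem_insert, mem_singleton]
    by_cases h : t = i ∨ t = j ∨ t = k
    · rw [if_pos h] at ht
      rw [← ht]
      cases u t <;> simp [h]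
    · rw [if_neg h] at ht
      rw [← ht]
      cases u t <;> simp [h]
  refine (card_le_card hsub).trans (card_image_le.trans ?_)
  rw [card_powerset]
  have h3 : ({i, j, k} : Finset (Fin n)).card ≤ 3 :=
    (card_insert_le _ _).trans (by
      have := card_insert_le j ({k} : Finset (Fin n))
      rw [card_singleton] at this
      omega)
  calc 2 ^ ({i, j, k} : Finset (Fin n)).card ≤ 2 ^ 3 := Nat.pow_le_pow_right (by norm_num) h3
    _ = 8 := by norm_num

/-- a completion of a cleared base point lies in its fibre. -/
theorem clr_fillS (i j k : Fin n) (u₀ : Fin n → Bool) (hu : u₀ i = false ∧ u₀ j = false ∧ u₀ k = false)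
    (S : Finset (Fin n)) (hS : S ⊆ {i, j, k}) : clr i j k (fillS u₀ S) = u₀ := by
  funext t
  simp only [clr, fillS]
  by_cases h : t = i ∨ t = j ∨ t = k
  · rw [if_pos h]
    rcases h with rfl | rfl | rfl
    · exact hu.1.symm
    · exact hu.2.1.symm
    · exact hu.2.2.symm
  · rw [if_neg h]
    have ht : t ∉ S := by
      intro htS
      have := hS htS
      simp only [mem_insert, mem_singleton] at this
      exact h this
    simp [ht]

/-- per fibre: `8 · #(WIN ∩ fibre) ≤ 7 · #fibre`. -/
theorem fibre_bound (c : ℕ) (y : Fin (n + 1) → (Fin n → Bool) → Bool) (i j k : Fin n) (hij : i < j) (hjk : j < k)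
    (hI : ∀ g u b, y g (Function.update u i b) = y g u) (hJ : ∀ g u b, y g (Function.update u j b) = y g u)
    (hK : ∀ g u b, y g (Function.update u k b) = y g u) (u₀ : Fin n → Bool) :
    8 * ((univ.filter fun u : Fin n → Bool => ringWinU c y u = true).filter
        fun u => clr i j k u = u₀).card
      ≤ 7 * (univ.filter fun u : Fin n → Bool => clr i j k u = u₀).card := by
  by_cases hu : u₀ i = false ∧ u₀ j = false ∧ u₀ k = false
  · obtain ⟨S, hS, hlose⟩ := exists_loser_fillS c y i j k hij hjk hI hJ hK u₀ hu
    have hmem : fillS u₀ S ∈ (univ.filter fun u : Fin n → Bool => clr i j k u = u₀) :=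
      mem_filter.mpr ⟨mem_univ _, clr_fillS i j k u₀ hu S hS⟩
    have hsub : ((univ.filter fun u : Fin n → Bool => ringWinU c y u = true).filter fun u => clr i j k u = u₀)
        ⊆ (univ.filter fun u : Fin n → Bool => clr i j k u = u₀).erase (fillS u₀ S) := by
      intro u hu'
      rw [mem_filter, mem_filter] at hu'
      rw [mem_erase, mem_filter]
      refine ⟨?_, mem_univ _, hu'.2⟩
      rintro rfl
      rw [hlose] at hu'
      exact Bool.false_ne_true hu'.1.2
    have h1 := card_le_card hsub
    rw [card_erase_of_mem hmem] at h1
    have h2 := card_fibre_le i j k u₀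
    have h3 : 0 < (univ.filter fun u : Fin n → Bool => clr i j k u = u₀).card := card_pos.mpr ⟨_, hmem⟩
    omega
  · -- the fibre is empty: a cleared point vanishes at `i, j, k`
    have hempty : ((univ.filter fun u : Fin n → Bool => ringWinU c y u = true).filter fun u => clr i j k u = u₀) = ∅ := by
      rw [filter_eq_empty_iff]
      intro u _ he
      apply hu
      rw [← he]
      simp [clr]
    rw [hempty, card_empty]
    omega

end Summit.QuantumAdvantage.AdviceFreeQNC0.OddConfig

namespace Summit.QuantumAdvantage.QuantumAdvantage.Theorems

open Finset Summit.QuantumAdvantage.AdviceFreeQNC0 Summit.QuantumAdvantage.AdviceFreeQNC0.OddConfig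

set_option linter.dupNamespace false in
/-- **THREE-BLIND-BITS LAW** (planner qa-qnc0-p2 g32, Sketch32 `ThreeBlindBitsLaw`, typed verbatim): a u-walk strategy that
ignores three input bits wins the ring game (any charge) on at most `7/8 · 2ⁿ` inputs. -/
theorem oddPrimeWalk_threeBlindBitsLaw :
    ∀ (n c : ℕ) (y : Fin (n + 1) → (Fin n → Bool) → Bool) (i j k : Fin n), i < j → j < k →
      (∀ g u b, y g (Function.update u i b) = y g u) →
      (∀ g u b, y g (Function.update u j b) = y g u) →
      (∀ g u b, y g (Function.update u k b) = y g u) →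
        8 * (Finset.univ.filter fun u : Fin n → Bool =>
              Summit.QuantumAdvantage.AdviceFreeQNC0.ringWinU c y u = true).card ≤ 7 * 2 ^ n := by
  intro n c y i j k hij hjk hI hJ hK
  have hW := card_eq_sum_card_fiberwise (s := univ.filter fun u : Fin n → Bool => ringWinU c y u = true)
    (t := (univ : Finset (Fin n → Bool))) (f := clr i j k) (fun u _ => mem_univ _)
  have hU := card_eq_sum_card_fiberwise (s := (univ : Finset (Fin n → Bool)))
    (t := (univ : Finset (Fin n → Bool))) (f := clr i j k) (fun u _ => mem_univ _)
  have h2n : (univ : Finset (Fin n → Bool)).card = 2 ^ n := by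
    rw [card_univ, Fintype.card_fun, Fintype.card_bool, Fintype.card_fin]
  rw [hW, mul_sum, ← h2n, hU, mul_sum]
  exact sum_le_sum fun u₀ _ => fibre_bound c y i j k hij hjk hI hJ hK u₀

end Summit.QuantumAdvantage.QuantumAdvantage.Theorems
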